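import Summits.QuantumFields.YangMills.Theorems.FluctuationComparisonRegPrIntLS2BetaFlatGapOfIsolated
import Summits.QuantumFields.YangMills.Theorems.FluctuationComparisonRegPrIntLClosedGoodFibre
import Summits.QuantumFields.YangMills.Theorems.UnitScaleTiltProp7FlatDatum
import HarnessLib

/-!
# S2β · THE FLAT INHABITANT OF THE (T)-CHAIN, OUTRIGHT: ORB̄(1,1) ∕ ISOL∘(δ)(1,1) ∕ TUBE♭(1,1) ∕ GAP♭(1,1) WITH NO LETTER LEFT
# (the Prop-7 letter at the flat datum is ✓`Prop7FlatDatum.atMostOneCriticalOrbit_one`, the closure letter CL(1) is ✓`exists_gamma_closedGoodFibre`)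

Cell `ym3-torus` (YM ladder rung R3 = continuum `SU(2)` Yang–Mills on the three-torus at fixed lattice data — a RUNG: NOT d = 4, NOT infinite volume,
NOT a mass gap, NOT Clay).  Width seat `ym3-torus-px12` (gen 21), absorbing `ym3-torus-px17` g15's LOCATE-FLAT-PROP7 offer under ★★OWNER g41 №273's one-copy
ruling; crux `stmt-QuantumFields-20520` (`…Theses.UnitScaleTilt.FluctuationComparisonRegPrIntL`), LINE S2β; `--kind proof --supports stmt-QuantumFields-20520 --as helper`:
count-neutral, DEFINITION-FREE (0 `def`, 0 `instance`, 0 `notation`, 0 `sorry`, default heartbeats).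

CREDIT.  ★p1-19200 g6 (`Prop7FlatDatum`: Prop. 7 clause 1 at the flat datum by flat rigidity — critical over `V ≡ 1` ⇒ action `0` ⇒ holonomy-flat ⇒ on print's
(4)-orbit of `1`, ZERO hypotheses, every `ε₀`, every member, every `L`); px17 g14 (`orbBar_one_of_prop7At`, `isol_of_orbBar`); cst-p1 g39 (CL: `exists_gamma_closedGoodFibre`);
px16 g17 bricks 1–5 + px21 g18 ∕ px8 g18 (T)-chain (`exists_tubeGrowth_flat_of_isolated`, `exists_gapFlat_flat_of_isolated`); px17 g15 LOCATE-FLAT-PROP7 (2026-08-31).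

WHY.  ✓brick 5 `…S2BetaFlatGapOfIsolated` §2 (RECORD 17fx) displayed two letters at the flat datum: `h7 : Prop7AtMostOneCriticalOrbitAt L a₀ B₃` (print's Prop. 7 cl. 1
as a window SCHEMA over all data) and CL(1).  But `h7` is consumed there ONLY at `V := 1`, through ✓`orbBar_one_of_prop7At`, whose one use of it is the instance
`(varProblem3 F J K hlt.le).AtMostOneCriticalOrbit ε₀ 1` — and that instance is the tree theorem ✓`Prop7FlatDatum.atMostOneCriticalOrbit_one ⟨(F,J,K), rfl, hlt⟩ ε₀`.
So `h7`, `hB₃`, `hε₀a` disappear (§1–§3), and CL(1) disappears for `γ ≤ γ₁^{CL}` (§4): the flat chain is hypothesis-free at every `L`.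

WHAT.
* §1 ★`orbBar_one_of_CL (hlt : J < K) (hε₀ : 0 < ε₀) (hCL)` — ORB̄(1,1) ⟸ CL(1): g14's proof of `orbBar_one_of_prop7At` with `hA := Prop7FlatDatum.atMostOneCriticalOrbit_one …`.
* §2 ★`isol_one_of_CL` — ISOL∘(δ)(1,1) ⟸ CL(1), every `δ` (∘ ✓`isol_of_orbBar`).
* §3 ★★`exists_tubeGrowth_flat_of_CL` ∕ ★★`exists_gapFlat_flat_of_CL` — ✓brick 5 §2 texts with the binders `h7 hB₃ … hε₀a` deleted and nothing else
  (∘ ✓brick 4 `exists_tubeGrowth_flat_of_isolated` ∕ ✓brick 5 §1 `exists_gapFlat_flat_of_isolated`, ISOL∘ by §2).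
* §4 ★★★`exists_tubeGrowth_flat` ∕ ★★★`exists_gapFlat_flat` — THE OUTRIGHT EDITIONS: binder list `{L, b₀, p₀, hb, hp, (δ, hδ)}` + regime only:
  `∃ γ₁ > 0, ∀ F (F.L = L), ∀ 0 < γ ≤ γ₁, ∀ J < K (K − J ≤ m + K_P), ∀ admissible ε₀, (∀ δ,) ∃ μ > 0,` TUBE♭(1,1) ∕ GAP♭(1,1)` — CL(1) by
  ✓`exists_gamma_closedGoodFibre` (`γ₁ ↦ min γ₁ γ₁^{CL}`).

HONEST.  One datum (the flat one).  [Balaban1985Variational] Prop. 7 cl. 1 at CURVED reducible data is NOT touched (✓px17 pen 4 = irreducible data; the flat datum needs no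
Prop-7 letter at all); HESS∘ at a general datum ([Balaban1985BackgroundPropagators] Thm 3.11), ISOL∘(δ) in general, TUBE-REG∘ (K-uniform μ), GAP♯∘, EXW∘, S2β and crux
20520 are NOT proved; rung R3 = `YM3TorusSU2` as filed — SU(2) YM₃ on T³; the Yang–Mills mass gap is NOT proved.  Sorry-free, axioms standard.
[cite: Balaban1985Variational, Prop. 7 and (142) p.299, (4)-(6) p.278, Thm 1 (8)-(10) p.279; Balaban1985UV3, (7) p.257, (12)-(13) p.259, (18)-(22) p.260, (41) p.266;
Balaban1987RG1, (0.4) and (0.11) p.253, (2.10) p.267]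
-/

set_option autoImplicit false

noncomputable section

open Set Filter Topology Function
open scoped Matrix.Norms.L2Operator
open Literature.MathematicalPhysics.QuantumFieldTheory.Balaban1983to89
open Literature.MathematicalPhysics.QuantumFieldTheory.Balaban1983to89.T3ContinuumYM3Torus
open Literature.MathematicalPhysics.QuantumFieldTheory.Balaban1983to89.T3UnitLawDensityEML (ℰp)
open Literature.MathematicalPhysics.QuantumFieldTheory.Balaban1983to89.T3UnitScaleTilt
open Literature.MathematicalPhysics.QuantumFieldTheory.Balaban1983to89.T3TiltDescent
open Literature.MathematicalPhysics.QuantumFieldTheory.Balaban1983to89.T3ConstrainedMinimiser (fibre)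
open Literature.MathematicalPhysics.QuantumFieldTheory.Balaban1983to89.T3PrintedRegularMinimiser
open Literature.MathematicalPhysics.QuantumFieldTheory.Balaban1983to89.T3Thm1Carrier (varProblem3)
open Literature.MathematicalPhysics.QuantumFieldTheory.Balaban1983to89.T4Continuum
open Literature.MathematicalPhysics.QuantumFieldTheory.Balaban1983to89.ExpMeanLog (deltaSU)
open Summit.QuantumFields.YangMills.Theorems.FluctuationComparisonRegPrIntLS2BetaFlatGapOfIsolated
  (one_mem_histGood_θBal exists_gapFlat_flat_of_isolated)
open Summit.QuantumFields.YangMills.Theorems.FluctuationComparisonRegPrIntLS2BetaFlatTubeGrowthOfIsolated (exists_tubeGrowth_flat_of_isolated)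
open Summit.QuantumFields.YangMills.Theorems.FluctuationComparisonRegPrIntLClosedGoodFibre (exists_gamma_closedGoodFibre)
open Summit.QuantumFields.YangMills.Theorems.FluctuationComparisonRegPrIntLOrbBarOfRegArgminBar (orbBar_of_atMostOneCriticalOrbit)
open Summit.QuantumFields.YangMills.Theorems.FluctuationComparisonRegPrIntLIsolOfOrbBar (isol_of_orbBar)
open Summit.QuantumFields.YangMills.Theorems.FluctuationComparisonRegPrIntLRegArgminFlat (regPr_of_flat plaqHol_eq_one_of_wilsonAction4_eq_zero')

namespace Summit.QuantumFields.YangMills.Theorems.FluctuationComparisonRegPrIntLS2BetaFlatGapOutright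

/-! ## §1 ORB̄(1,1) ⟸ CL(1) — the Prop-7 letter at the flat datum is a tree theorem -/

section Orb

variable (F : T3Family) {J K : ℕ} {γ b₀ p₀ ε₀ : ℝ}

/-- ★ **ORB̄ OVER THE FLAT DATUM AT EVERY DEPTH ⟸ CL(1) ALONE** (`J < K`, `0 < ε₀`): every closed-window achiever over `V ≡ 1` (`U ∈ closure (fibre 1 ∩ histGood)`,
`A U ≤ minActionRegPr … ε₀ 1`) is a residual translate of `1`.  This is px17 g14's ✓`orbBar_one_of_prop7At` with its Prop-7 input `hA` supplied by the tree theorem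
✓`Prop7FlatDatum.atMostOneCriticalOrbit_one ⟨(F,J,K), rfl, hlt⟩ ε₀` (★p1-19200 g6: flat rigidity — a reading-R2 critical configuration over `V ≡ 1` has action `0`, is
holonomy-flat, and lies on print's (4)-orbit of `1`); REG-ARGMIN̄(1) is free as there (an achiever has `A ≤ 0`, is flat, hence (6)-regular ✓`regPr_of_flat`).
[cite: Balaban1985Variational, Prop. 7 p.299 and (4)-(6) p.278; Balaban1987RG1, (0.4) p.253] -/
theorem orbBar_one_of_CL (hlt : J < K) (hε₀ : 0 < ε₀)
    (hCL : closure (fibre F ℰp J K hlt.le 1 ∩ histGood F ℰp (θBal F.L γ b₀ p₀) K J) ⊆ fibre F ℰp J K hlt.le 1) :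
    ∀ U ∈ closure (fibre F ℰp J K hlt.le 1 ∩ histGood F ℰp (θBal F.L γ b₀ p₀) K J),
      wilsonAction4 U ≤ minActionRegPr F J K hlt.le ε₀ 1 →
        ∃ w : Site (F.P K) 0 → Matrix.specialUnitaryGroup (Fin 2) ℂ,
          (∀ U' : GaugeField (F.P K) 0 (Matrix.specialUnitaryGroup (Fin 2) ℂ),
              descendTo F ℰp J K hlt.le (GaugeField.gaugeAct w U') = descendTo F ℰp J K hlt.le U') ∧
            U = GaugeField.gaugeAct w 1 := by
  have hA : (varProblem3 F J K hlt.le).AtMostOneCriticalOrbit ε₀ (1 : GaugeField (F.P J) 0 (Matrix.specialUnitaryGroup (Fin 2) ℂ)) :=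
    Prop7FlatDatum.atMostOneCriticalOrbit_one (L := F.L) ⟨(F, J, K), rfl, hlt⟩ ε₀
  refine orbBar_of_atMostOneCriticalOrbit F hlt.le hε₀ hA (one_mem_regFibrePr_one F hε₀) ?_ ?_ hCL
  · rw [minActionRegPr_one F hε₀, ← T3DescentFibreTower.minAction_self F ℰp K 1]
    exact T3DescentFibreTower.minAction_one F ℰp T3DescentFibreTower.expMeanLogSU_E_one le_rfl
  · intro U _ hle
    have hA0 : wilsonAction4 U = 0 := by
      rw [minActionRegPr_one F hε₀] at hle
      exact le_antisymm hle (wilsonAction4_nonneg U)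
    exact regPr_of_flat F hε₀ (plaqHol_eq_one_of_wilsonAction4_eq_zero' F U hA0)

/-! ## §2 ISOL∘(δ)(1,1) ⟸ CL(1), every `δ` -/

/-- ★ **ISOL∘(δ) AT THE FLAT DATUM ⟸ CL(1) ALONE**, for every tube radius `δ` (`J < K`, `0 < ε₀`): at every closed-window achiever over `V ≡ 1` the residual orbit functional
`⨅_{w residual} Σ_ℓ dist1 (U ℓ·((w•1) ℓ)⁻¹)²` vanishes — §1 ∘ ✓`isol_of_orbBar`; the `hisol` letter of ✓brick 4 `exists_tubeGrowth_flat_of_isolated` ∕ ✓brick 5 §1, token for token.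
[cite: Balaban1985Variational, Prop. 7 p.299; Balaban1985UV3, (12)-(13) p.259] -/
theorem isol_one_of_CL (hlt : J < K) (hε₀ : 0 < ε₀)
    (hCL : closure (fibre F ℰp J K hlt.le 1 ∩ histGood F ℰp (θBal F.L γ b₀ p₀) K J) ⊆ fibre F ℰp J K hlt.le 1) (δ : ℝ) :
    ∀ U ∈ closure (fibre F ℰp J K hlt.le (1 : GaugeField (F.P J) 0 (Matrix.specialUnitaryGroup (Fin 2) ℂ)) ∩ histGood F ℰp (θBal F.L γ b₀ p₀) K J),
      (∃ w : Site (F.P K) 0 → Matrix.specialUnitaryGroup (Fin 2) ℂ,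
        (∀ U'' : GaugeField (F.P K) 0 (Matrix.specialUnitaryGroup (Fin 2) ℂ),
            descendTo F ℰp J K hlt.le (GaugeField.gaugeAct w U'') = descendTo F ℰp J K hlt.le U'') ∧
          ∀ ℓ : PBond (F.P K) 0, dist1 (U ℓ * ((GaugeField.gaugeAct w (1 : GaugeField (F.P K) 0 (Matrix.specialUnitaryGroup (Fin 2) ℂ))) ℓ)⁻¹) ≤ δ) →
      wilsonAction4 U ≤ minActionRegPr F J K hlt.le ε₀ (1 : GaugeField (F.P J) 0 (Matrix.specialUnitaryGroup (Fin 2) ℂ)) →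
      (⨅ w : {w : Site (F.P K) 0 → Matrix.specialUnitaryGroup (Fin 2) ℂ |
          ∀ U : GaugeField (F.P K) 0 (Matrix.specialUnitaryGroup (Fin 2) ℂ),
            descendTo F ℰp J K hlt.le (GaugeField.gaugeAct w U) = descendTo F ℰp J K hlt.le U},
        ∑ ℓ : PBond (F.P K) 0,
          dist1 (U ℓ * ((GaugeField.gaugeAct (w : Site (F.P K) 0 → Matrix.specialUnitaryGroup (Fin 2) ℂ) (1 : GaugeField (F.P K) 0 (Matrix.specialUnitaryGroup (Fin 2) ℂ))) ℓ)⁻¹) ^ 2) = 0 :=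
  isol_of_orbBar F hlt.le 1 1 δ (orbBar_one_of_CL F hlt hε₀ hCL)

end Orb

/-! ## §3 TUBE♭(1,1) ∕ GAP♭(1,1) ⟸ CL(1) — ✓brick 5 §2 with the Prop-7 binders deleted -/

/-- ★★ **TUBE♭(1,1) ⟸ CL(1) ALONE** (`J < K`, `K − J ≤ m + K_P`, admissible `ε₀`; every tube radius `δ`): ✓brick 4 `exists_tubeGrowth_flat_of_isolated` with «`1` is a good
history» by ✓`one_mem_histGood_θBal` and its ISOL∘(δ)(1,1) letter by §2.  The text is ✓brick 5 `exists_tubeGrowth_flat_of_prop7At` with the binders `h7 hB₃ … hε₀a` deleted.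
[cite: Balaban1985Variational, Prop. 7 and (142) p.299, (6) p.278; Balaban1985UV3, (7) p.257, (18)-(22) p.260] -/
theorem exists_tubeGrowth_flat_of_CL (L : ℕ) (b₀ p₀ : ℝ) (hb : 0 < b₀) (hp : 0 < p₀) :
    ∃ γ₁ : ℝ, 0 < γ₁ ∧ ∀ (F : T3Family) (γ : ℝ), F.L = L → 0 < γ → γ ≤ γ₁ →
      ∀ (J K : ℕ) (hlt : J < K) (hk : K - J ≤ (F.P K).m + (F.P K).K)
        (ε₀ : ℝ), 0 < ε₀ → (143 * ((((3 + 4 : ℕ) : ℝ)) ^ 2 / 4) ^ 2) * (2 * ε₀) ≤ 1 / 3 →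
          2 * (2 * ε₀) ≤ 2 * deltaSU (Fin 2) / (((3 + 4) * F.L : ℕ) : ℝ) ^ 2 →
        closure (fibre F ℰp J K hlt.le 1 ∩ histGood F ℰp (θBal F.L γ b₀ p₀) K J) ⊆ fibre F ℰp J K hlt.le 1 →
        ∀ δ : ℝ,
          ∃ μ : ℝ, 0 < μ ∧ ∀ U ∈ fibre F ℰp J K hlt.le (1 : GaugeField (F.P J) 0 (Matrix.specialUnitaryGroup (Fin 2) ℂ)), U ∈ histGood F ℰp (θBal F.L γ b₀ p₀) K J →
          (∃ w : Site (F.P K) 0 → Matrix.specialUnitaryGroup (Fin 2) ℂ,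
          (∀ U'' : GaugeField (F.P K) 0 (Matrix.specialUnitaryGroup (Fin 2) ℂ),
          descendTo F ℰp J K hlt.le (GaugeField.gaugeAct w U'') = descendTo F ℰp J K hlt.le U'') ∧
          ∀ ℓ : PBond (F.P K) 0, dist1 (U ℓ * ((GaugeField.gaugeAct w (1 : GaugeField (F.P K) 0 (Matrix.specialUnitaryGroup (Fin 2) ℂ))) ℓ)⁻¹) ≤ δ) →
          μ * ((F.L : ℝ)⁻¹) ^ (2 * (K - J)) *
          (⨅ w : {w : Site (F.P K) 0 → Matrix.specialUnitaryGroup (Fin 2) ℂ |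
          ∀ U : GaugeField (F.P K) 0 (Matrix.specialUnitaryGroup (Fin 2) ℂ),
          descendTo F ℰp J K hlt.le (GaugeField.gaugeAct w U) = descendTo F ℰp J K hlt.le U},
          ∑ ℓ : PBond (F.P K) 0,
          dist1 (U ℓ * ((GaugeField.gaugeAct (w : Site (F.P K) 0 → Matrix.specialUnitaryGroup (Fin 2) ℂ) (1 : GaugeField (F.P K) 0 (Matrix.specialUnitaryGroup (Fin 2) ℂ))) ℓ)⁻¹) ^ 2)
          ≤ wilsonAction4 U - minActionRegPr F J K hlt.le ε₀ (1 : GaugeField (F.P J) 0 (Matrix.specialUnitaryGroup (Fin 2) ℂ)) := by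
  obtain ⟨γ₁, hγ₁, hmain⟩ := exists_tubeGrowth_flat_of_isolated L b₀ p₀ hb hp
  refine ⟨min γ₁ 1, lt_min hγ₁ one_pos, ?_⟩
  intro F γ hFL hγ hγle J K hlt hk ε₀ hε₀ hr3 hr2 hCL δ
  exact hmain F γ hFL hγ (hγle.trans (min_le_left _ _)) J K hlt.le hk ε₀ hε₀ hr3 hr2
    (one_mem_histGood_θBal F hγ (hγle.trans (min_le_right _ _)) hb p₀ K J) δ (isol_one_of_CL F hlt hε₀ hCL δ)

/-- ★★ **GAP♭(1,1) ⟸ CL(1) ALONE**, for `γ ≤ γ₁(δ)` (`J < K`, `K − J ≤ m + K_P`, admissible `ε₀`): ✓brick 5 §1 `exists_gapFlat_flat_of_isolated` (HESS∘ at the flat datum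
discharged there) with its ISOL∘(δ)(1,1) letter by §2.  The text is ✓brick 5 `exists_gapFlat_flat_of_prop7At` with the binders `h7 hB₃ … hε₀a` deleted.
[cite: Balaban1985Variational, Prop. 7 and (142) p.299, Thm 1 (8)-(10) p.279; Balaban1985UV3, (12)-(13) p.259, (18)-(22) p.260; Balaban1987RG1, (2.10) p.267] -/
theorem exists_gapFlat_flat_of_CL (L : ℕ) (b₀ p₀ : ℝ) (hb : 0 < b₀) (hp : 0 < p₀) (δ : ℝ) (hδ : 0 < δ) :
    ∃ γ₁ : ℝ, 0 < γ₁ ∧ ∀ (F : T3Family) (γ : ℝ), F.L = L → 0 < γ → γ ≤ γ₁ →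
      ∀ (J K : ℕ) (hlt : J < K) (hk : K - J ≤ (F.P K).m + (F.P K).K)
        (ε₀ : ℝ), 0 < ε₀ → (143 * ((((3 + 4 : ℕ) : ℝ)) ^ 2 / 4) ^ 2) * (2 * ε₀) ≤ 1 / 3 →
          2 * (2 * ε₀) ≤ 2 * deltaSU (Fin 2) / (((3 + 4) * F.L : ℕ) : ℝ) ^ 2 →
        closure (fibre F ℰp J K hlt.le 1 ∩ histGood F ℰp (θBal F.L γ b₀ p₀) K J) ⊆ fibre F ℰp J K hlt.le 1 →
        ∃ μ : ℝ, 0 < μ ∧ ∀ U ∈ fibre F ℰp J K hlt.le (1 : GaugeField (F.P J) 0 (Matrix.specialUnitaryGroup (Fin 2) ℂ)), U ∈ histGood F ℰp (θBal F.L γ b₀ p₀) K J →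
        μ * ((F.L : ℝ)⁻¹) ^ (2 * (K - J)) *
        (⨅ w : {w : Site (F.P K) 0 → Matrix.specialUnitaryGroup (Fin 2) ℂ |
        ∀ U : GaugeField (F.P K) 0 (Matrix.specialUnitaryGroup (Fin 2) ℂ),
        descendTo F ℰp J K hlt.le (GaugeField.gaugeAct w U) = descendTo F ℰp J K hlt.le U},
        ∑ ℓ : PBond (F.P K) 0,
        dist1 (U ℓ * ((GaugeField.gaugeAct (w : Site (F.P K) 0 → Matrix.specialUnitaryGroup (Fin 2) ℂ) (1 : GaugeField (F.P K) 0 (Matrix.specialUnitaryGroup (Fin 2) ℂ))) ℓ)⁻¹) ^ 2)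
        ≤ wilsonAction4 U - minActionRegPr F J K hlt.le ε₀ (1 : GaugeField (F.P J) 0 (Matrix.specialUnitaryGroup (Fin 2) ℂ)) := by
  obtain ⟨γ₁, hγ₁, hmain⟩ := exists_gapFlat_flat_of_isolated L b₀ p₀ hb hp δ hδ
  refine ⟨γ₁, hγ₁, ?_⟩
  intro F γ hFL hγ hγle J K hlt hk ε₀ hε₀ hr3 hr2 hCL
  exact hmain F γ hFL hγ hγle J K hlt.le hk ε₀ hε₀ hr3 hr2 (isol_one_of_CL F hlt hε₀ hCL δ)

/-! ## §4 The outright editions — CL(1) by ✓`exists_gamma_closedGoodFibre` -/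

/-- ★★★ **TUBE♭ AT THE FLAT DATUM, OUTRIGHT**: for every `L`, `0 < b₀`, `0 < p₀` there is `γ₁ > 0` such that for every family `F` with `F.L = L`, every `0 < γ ≤ γ₁`,
every `J < K` with `K − J ≤ m + K_P`, every admissible `ε₀` and EVERY tube radius `δ`: `∃ μ > 0`, `μ·L^{−2(K−J)}·⨅_w Σ dist1² ≤ A U − min₍₆₎(1)` for every good history
`U` of the flat fibre in the residual `δ`-tube of `1`.  No letter: HESS∘(1) by ✓bricks 1–4, ISOL∘(δ)(1,1) by §2 (flat Prop 7 ✓g6), CL(1) by ✓`exists_gamma_closedGoodFibre`.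
[cite: Balaban1985Variational, Prop. 7 and (142) p.299, (4)-(6) p.278; Balaban1985UV3, (7) p.257, (18)-(22) p.260, (41) p.266; Balaban1987RG1, (0.11) p.253] -/
theorem exists_tubeGrowth_flat (L : ℕ) (b₀ p₀ : ℝ) (hb : 0 < b₀) (hp : 0 < p₀) :
    ∃ γ₁ : ℝ, 0 < γ₁ ∧ ∀ (F : T3Family) (γ : ℝ), F.L = L → 0 < γ → γ ≤ γ₁ →
      ∀ (J K : ℕ) (hlt : J < K) (hk : K - J ≤ (F.P K).m + (F.P K).K)
        (ε₀ : ℝ), 0 < ε₀ → (143 * ((((3 + 4 : ℕ) : ℝ)) ^ 2 / 4) ^ 2) * (2 * ε₀) ≤ 1 / 3 →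
          2 * (2 * ε₀) ≤ 2 * deltaSU (Fin 2) / (((3 + 4) * F.L : ℕ) : ℝ) ^ 2 →
        ∀ δ : ℝ,
          ∃ μ : ℝ, 0 < μ ∧ ∀ U ∈ fibre F ℰp J K hlt.le (1 : GaugeField (F.P J) 0 (Matrix.specialUnitaryGroup (Fin 2) ℂ)), U ∈ histGood F ℰp (θBal F.L γ b₀ p₀) K J →
          (∃ w : Site (F.P K) 0 → Matrix.specialUnitaryGroup (Fin 2) ℂ,
          (∀ U'' : GaugeField (F.P K) 0 (Matrix.specialUnitaryGroup (Fin 2) ℂ),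
          descendTo F ℰp J K hlt.le (GaugeField.gaugeAct w U'') = descendTo F ℰp J K hlt.le U'') ∧
          ∀ ℓ : PBond (F.P K) 0, dist1 (U ℓ * ((GaugeField.gaugeAct w (1 : GaugeField (F.P K) 0 (Matrix.specialUnitaryGroup (Fin 2) ℂ))) ℓ)⁻¹) ≤ δ) →
          μ * ((F.L : ℝ)⁻¹) ^ (2 * (K - J)) *
          (⨅ w : {w : Site (F.P K) 0 → Matrix.specialUnitaryGroup (Fin 2) ℂ |
          ∀ U : GaugeField (F.P K) 0 (Matrix.specialUnitaryGroup (Fin 2) ℂ),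
          descendTo F ℰp J K hlt.le (GaugeField.gaugeAct w U) = descendTo F ℰp J K hlt.le U},
          ∑ ℓ : PBond (F.P K) 0,
          dist1 (U ℓ * ((GaugeField.gaugeAct (w : Site (F.P K) 0 → Matrix.specialUnitaryGroup (Fin 2) ℂ) (1 : GaugeField (F.P K) 0 (Matrix.specialUnitaryGroup (Fin 2) ℂ))) ℓ)⁻¹) ^ 2)
          ≤ wilsonAction4 U - minActionRegPr F J K hlt.le ε₀ (1 : GaugeField (F.P J) 0 (Matrix.specialUnitaryGroup (Fin 2) ℂ)) := by
  obtain ⟨γ₁, hγ₁, hmain⟩ := exists_tubeGrowth_flat_of_CL L b₀ p₀ hb hp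
  obtain ⟨γ₂, hγ₂, -, hCL⟩ := exists_gamma_closedGoodFibre L hb hp
  refine ⟨min γ₁ γ₂, lt_min hγ₁ hγ₂, ?_⟩
  intro F γ hFL hγ hγle J K hlt hk ε₀ hε₀ hr3 hr2 δ
  exact hmain F γ hFL hγ (hγle.trans (min_le_left _ _)) J K hlt hk ε₀ hε₀ hr3 hr2
    (hCL F γ hFL hγ (hγle.trans (min_le_right _ _)) J K hlt.le 1) δ

/-- ★★★ **GAP♭ AT THE FLAT DATUM, OUTRIGHT**: for every `L`, `0 < b₀`, `0 < p₀` and every tube radius `δ > 0` there is `γ₁ > 0` such that for every family `F` with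
`F.L = L`, every `0 < γ ≤ γ₁`, every `J < K` with `K − J ≤ m + K_P` and every admissible `ε₀`: `∃ μ > 0`, `μ·L^{−2(K−J)}·⨅_w Σ dist1² ≤ A U − min₍₆₎(1)` for EVERY good
history `U` of the flat fibre.  No letter: HESS∘(1) by ✓bricks 1–4 (through ✓(T3)), ISOL∘(δ)(1,1) by §2 (flat Prop 7 ✓g6), CL(1) by ✓`exists_gamma_closedGoodFibre`, CLOSE-PAIR∘ by ✓px8.
[cite: Balaban1985Variational, Prop. 7 and (142) p.299, Thm 1 (8)-(10) p.279; Balaban1985UV3, (7) p.257, (12)-(13) p.259, (18)-(22) p.260, (41) p.266; Balaban1987RG1, (2.10) p.267] -/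
theorem exists_gapFlat_flat (L : ℕ) (b₀ p₀ : ℝ) (hb : 0 < b₀) (hp : 0 < p₀) (δ : ℝ) (hδ : 0 < δ) :
    ∃ γ₁ : ℝ, 0 < γ₁ ∧ ∀ (F : T3Family) (γ : ℝ), F.L = L → 0 < γ → γ ≤ γ₁ →
      ∀ (J K : ℕ) (hlt : J < K) (hk : K - J ≤ (F.P K).m + (F.P K).K)
        (ε₀ : ℝ), 0 < ε₀ → (143 * ((((3 + 4 : ℕ) : ℝ)) ^ 2 / 4) ^ 2) * (2 * ε₀) ≤ 1 / 3 →
          2 * (2 * ε₀) ≤ 2 * deltaSU (Fin 2) / (((3 + 4) * F.L : ℕ) : ℝ) ^ 2 →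
        ∃ μ : ℝ, 0 < μ ∧ ∀ U ∈ fibre F ℰp J K hlt.le (1 : GaugeField (F.P J) 0 (Matrix.specialUnitaryGroup (Fin 2) ℂ)), U ∈ histGood F ℰp (θBal F.L γ b₀ p₀) K J →
        μ * ((F.L : ℝ)⁻¹) ^ (2 * (K - J)) *
        (⨅ w : {w : Site (F.P K) 0 → Matrix.specialUnitaryGroup (Fin 2) ℂ |
        ∀ U : GaugeField (F.P K) 0 (Matrix.specialUnitaryGroup (Fin 2) ℂ),
        descendTo F ℰp J K hlt.le (GaugeField.gaugeAct w U) = descendTo F ℰp J K hlt.le U},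
        ∑ ℓ : PBond (F.P K) 0,
        dist1 (U ℓ * ((GaugeField.gaugeAct (w : Site (F.P K) 0 → Matrix.specialUnitaryGroup (Fin 2) ℂ) (1 : GaugeField (F.P K) 0 (Matrix.specialUnitaryGroup (Fin 2) ℂ))) ℓ)⁻¹) ^ 2)
        ≤ wilsonAction4 U - minActionRegPr F J K hlt.le ε₀ (1 : GaugeField (F.P J) 0 (Matrix.specialUnitaryGroup (Fin 2) ℂ)) := by
  obtain ⟨γ₁, hγ₁, hmain⟩ := exists_gapFlat_flat_of_CL L b₀ p₀ hb hp δ hδ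
  obtain ⟨γ₂, hγ₂, -, hCL⟩ := exists_gamma_closedGoodFibre L hb hp
  refine ⟨min γ₁ γ₂, lt_min hγ₁ hγ₂, ?_⟩
  intro F γ hFL hγ hγle J K hlt hk ε₀ hε₀ hr3 hr2
  exact hmain F γ hFL hγ (hγle.trans (min_le_left _ _)) J K hlt hk ε₀ hε₀ hr3 hr2
    (hCL F γ hFL hγ (hγle.trans (min_le_right _ _)) J K hlt.le 1)

end Summit.QuantumFields.YangMills.Theorems.FluctuationComparisonRegPrIntLS2BetaFlatGapOutright

end
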